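import Summits.Ventures.Crystal3D.Theorems.StickyWulffConstantPolycrystalWulffBoundTwinBodyChange
import Summits.Ventures.Crystal3D.Theorems.StickyWulffConstantPolycrystalWulffBoundNearTwinArith

/-!
# `PolycrystalWulffBound`, lane P: the NEAR-TWIN REDUCTION — geometric half
# (helper for crux `stmt-Ventures-19482`; poly-p2 g22; memo `HOME/poly-p2/C1-COST-g21.md` §7, Lemma 7.1)

Route `StickyWulffConstant` of the venture `Summits/Ventures/Crystal3D`, second prover lane.  The certified
«∀R» column of lane P covers the cubic misorientation cell by boxes on which `D_F(R) < 1`; the one region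
where a box count diverges is the neighbourhood of the TWIN vertex Σ3, the crux's only co-axial
misorientation.  There the generic two-grain inequality at wall constant `c ≥ 1` follows from the
CO-AXIAL twin inequality at charge `½` by an elementary two-case argument whose real arithmetic is
`nearTwin_arith` (p746232).  This file is the GEOMETRIC HALF, at the level of bodies (sets): for a disjoint
pair of polyhedral grains `S₁, S₂` of finite volume and bodies

* `W₁, W₂` (the two grains' Wulff bodies: compact, convex, `0 ∈`, `B̄(0,√3) ⊆ W_i ⊆ B̄(0,√5)`, `W₂` symmetric),
* `W₂'` (a TWIN body for grain 2: compact convex symmetric `∋ 0`) with the one-sided support gap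
  `h_{W₂'}(ν) ≤ h_{W₂}(ν) + ε·h_{B̄(0,1)}(ν)` for all `ν`,
* a wall kernel `Dm ⊆ B̄(0,1)` (compact convex `∋ 0`),

the TWIN inequality for `(W₁, W₂'; ½·Dm)` on `(S₁, S₂)`, the Wulff inequality for each grain and
`2(2√5 − 1)·ε ≤ √3/3` give the GENERIC-FORM inequality for `(W₁, W₂; c·B̄(0,1))` on `(S₁, S₂)` for every
`c ≥ 1`, provided `|S₂| ≤ |S₁|` (`twoGrain_nearTwin_of_volume_le`); the symmetric statement without the
volume ordering takes a twin body on either side (`twoGrain_nearTwin`).  The crux-level corollaries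
(frames `A`, `B` near a twin pair, `TwoGrainTwinInequality` by name) are the companion file
`…NearTwinReductionCrux`.

Facts of the facet calculus used (all landed): the free energy of a grain is half its cross sum with
the exterior cells and the wall term is a cross sum (`exists_exterior_crossSums`), cross sums are
monotone / comparable under support gaps (`crossSum_mono`, `crossSum_le_add_of_supportFn_le`) and
nonnegative; `per (B̄(0,r)) = r·Per`; the Wulff bodies' radii.  Pair-form bookkeeping lemmas:
`hasFinitePerimeter_of_poly`, `pair_texture`, `toReal_volume_union_pair`, `pair_iota_nonneg`,
`pair_iota_mono`, `pair_iota_closedBall`, `pair_freeEnergy_le_add_of_gap`, `pair_freeArea_nonneg`,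
`per_mono_of_subset`.

WHAT THIS IS NOT: the twin inequality (lane P's named fact `TwoGrainTwinInequality`, not proved in the
kernel); nothing on the crux beyond this reduction; rung F-C1 not moved.
-/

noncomputable section

namespace Summit.Ventures.Crystal3D.Theorems

open MeasureTheory Set Metric
open scoped RealInnerProductSpace ENNReal Pointwise
open Summit.Ventures.Crystal3D.Cruxes.TextureLiminf.TexShadow
open Literature.Analysis.Convexity
open Literature.MathematicalPhysics.StatisticalMechanics (perimeter HasFinitePerimeter)

/-! ### Polyhedral sets: finite perimeter, the two-grain family of a pair -/

/-- **A polyhedral (`Poly`) set of finite volume has finite perimeter**: it is a.e. a finite disjoint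
union of bounded cells (`exists_disjoint_polytope_refinement_of_volume_lt_top`), whose union has finite
`B̄(0,1)`-perimeter (`perK_biUnion_polytope_ne_top`). -/
theorem hasFinitePerimeter_of_poly {S : Set E3}
    (hS : ∃ (k : ℕ) (H : Fin k → Finset (E3 × ℝ)), S = ⋃ i, polytope (H i))
    (hv : volume S < ⊤) : HasFinitePerimeter S := by
  obtain ⟨k, H, rfl⟩ := hS
  refine ⟨MeasurableSet.iUnion fun i => measurableSet_polytope (H i), ?_⟩
  obtain ⟨k', H', ν, hbd, hunit, hdist, hdisj, -, -, hae⟩ :=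
    exists_disjoint_polytope_refinement_of_volume_lt_top (E := E3) H hv
  have hae' : (⋃ i, polytope (H i)) =ᵐ[volume] ⋃ j, polytope (H' j) := hae
  rw [perimeter_eq_anisotropicPerimeter_closedBall, anisotropicPerimeter_congr_ae _ hae',
    ← biUnion_univ_eq_iUnion, ← perK_eq_anisotropicPerimeter]
  exact lt_top_iff_ne_top.2 (perK_biUnion_polytope_ne_top (isCompact_closedBall 0 1)
    (convex_closedBall 0 1) (mem_closedBall_self zero_le_one) H' hbd hunit hdist hdisj Finset.univ)

/-- The two-grain family `![S₁, S₂]` of a disjoint polyhedral pair of finite volume is a texture of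
the kind the exterior calculus consumes: `Poly` grains, finite volumes, pairwise disjoint. -/
theorem pair_texture {S₁ S₂ : Set E3}
    (hP₁ : ∃ (k : ℕ) (H : Fin k → Finset (E3 × ℝ)), S₁ = ⋃ i, polytope (H i))
    (hP₂ : ∃ (k : ℕ) (H : Fin k → Finset (E3 × ℝ)), S₂ = ⋃ i, polytope (H i))
    (hv₁ : volume S₁ < ⊤) (hv₂ : volume S₂ < ⊤) (hd : Disjoint S₁ S₂) :
    (∀ f : Fin 2, ∃ (k : ℕ) (H : Fin k → Finset (E3 × ℝ)),
        (![S₁, S₂] : Fin 2 → Set E3) f = ⋃ i, polytope (H i)) ∧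
      (∀ f : Fin 2, volume ((![S₁, S₂] : Fin 2 → Set E3) f) < ⊤) ∧
      (∀ f g : Fin 2, f ≠ g →
        Disjoint ((![S₁, S₂] : Fin 2 → Set E3) f) ((![S₁, S₂] : Fin 2 → Set E3) g)) := by
  refine ⟨?_, ?_, ?_⟩
  · intro f
    fin_cases f
    · exact hP₁
    · exact hP₂
  · intro f
    fin_cases f
    · exact hv₁
    · exact hv₂
  · intro f g hfg
    fin_cases f <;> fin_cases g
    · exact absurd rfl hfg
    · exact hd
    · exact hd.symm
    · exact absurd rfl hfg

/-- `|S₁ ∪ S₂| = |S₁| + |S₂|` (real volumes) for a disjoint polyhedral pair of finite volume. -/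
theorem toReal_volume_union_pair {S₁ S₂ : Set E3}
    (hP₂ : ∃ (k : ℕ) (H : Fin k → Finset (E3 × ℝ)), S₂ = ⋃ i, polytope (H i))
    (hv₁ : volume S₁ < ⊤) (hv₂ : volume S₂ < ⊤) (hd : Disjoint S₁ S₂) :
    (volume (S₁ ∪ S₂)).toReal = (volume S₁).toReal + (volume S₂).toReal := by
  rw [measure_union hd (hasFinitePerimeter_of_poly hP₂ hv₂).1, ENNReal.toReal_add hv₁.ne hv₂.ne]

/-! ### The wall term and the free energy of a PAIR: nonnegative, monotone, comparable -/

/-- **The wall term of a pair is nonnegative**: `0 ≤ per K S₁ + per K S₂ − per K (S₁ ∪ S₂)` for a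
disjoint polyhedral pair and a compact convex `K ∋ 0`. -/
theorem pair_iota_nonneg {S₁ S₂ : Set E3}
    (hP₁ : ∃ (k : ℕ) (H : Fin k → Finset (E3 × ℝ)), S₁ = ⋃ i, polytope (H i))
    (hP₂ : ∃ (k : ℕ) (H : Fin k → Finset (E3 × ℝ)), S₂ = ⋃ i, polytope (H i))
    (hv₁ : volume S₁ < ⊤) (hv₂ : volume S₂ < ⊤) (hd : Disjoint S₁ S₂)
    {K : Set E3} (hK : IsCompact K) (hKc : Convex ℝ K) (h0 : (0 : E3) ∈ K) :
    0 ≤ per K S₁ + per K S₂ - per K (S₁ ∪ S₂) := by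
  obtain ⟨hPoly, hvol, hdisjG⟩ := pair_texture hP₁ hP₂ hv₁ hv₂ hd
  have h01 : (0 : Fin 2) ≠ 1 := by decide
  have h := iota_nonneg_of_poly (![S₁, S₂] : Fin 2 → Set E3) hPoly hvol hdisjG hK hKc h0 h01
  have hG0 : (![S₁, S₂] : Fin 2 → Set E3) 0 = S₁ := rfl
  have hG1 : (![S₁, S₂] : Fin 2 → Set E3) 1 = S₂ := rfl
  rw [hG0, hG1] at h
  exact h

/-- **The wall term of a pair is monotone in the body**: `K ⊆ K'` (both compact convex `∋ 0`) gives
`per K S₁ + per K S₂ − per K (S₁ ∪ S₂) ≤ per K' S₁ + per K' S₂ − per K' (S₁ ∪ S₂)` (the wall term is a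
cross sum, `crossSum_mono`). -/
theorem pair_iota_mono {S₁ S₂ : Set E3}
    (hP₁ : ∃ (k : ℕ) (H : Fin k → Finset (E3 × ℝ)), S₁ = ⋃ i, polytope (H i))
    (hP₂ : ∃ (k : ℕ) (H : Fin k → Finset (E3 × ℝ)), S₂ = ⋃ i, polytope (H i))
    (hv₁ : volume S₁ < ⊤) (hv₂ : volume S₂ < ⊤) (hd : Disjoint S₁ S₂)
    {K K' : Set E3} (hK : IsCompact K) (hKc : Convex ℝ K) (h0 : (0 : E3) ∈ K)
    (hK' : IsCompact K') (hKc' : Convex ℝ K') (h0' : (0 : E3) ∈ K') (hKK' : K ⊆ K') :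
    per K S₁ + per K S₂ - per K (S₁ ∪ S₂) ≤ per K' S₁ + per K' S₂ - per K' (S₁ ∪ S₂) := by
  obtain ⟨hPoly, hvol, hdisjG⟩ := pair_texture hP₁ hP₂ hv₁ hv₂ hd
  have h01 : (0 : Fin 2) ≠ 1 := by decide
  obtain ⟨k, H, ν, S, SX, hwall, -, -⟩ :=
    exists_exterior_crossSums (![S₁, S₂] : Fin 2 → Set E3) hPoly hvol hdisjG
  have h := hwall K hK hKc h0 0 1 h01
  have h' := hwall K' hK' hKc' h0' 0 1 h01
  have hG0 : (![S₁, S₂] : Fin 2 → Set E3) 0 = S₁ := rfl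
  have hG1 : (![S₁, S₂] : Fin 2 → Set E3) 1 = S₂ := rfl
  rw [hG0, hG1] at h h'
  rw [h, h']
  exact crossSum_mono hKK' hK'.isBounded ⟨0, h0⟩ H ν (S 0) (S 1)

/-- **The ball wall term scales with the radius**: `per (B̄(0,r)) S₁ + per (B̄(0,r)) S₂ − per (B̄(0,r)) (S₁ ∪ S₂)
 = r · (the same for B̄(0,1))` (`r > 0`). -/
theorem pair_iota_closedBall (S₁ S₂ : Set E3) {r : ℝ} (hr : 0 < r) :
    per (closedBall (0 : E3) r) S₁ + per (closedBall (0 : E3) r) S₂ -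
        per (closedBall (0 : E3) r) (S₁ ∪ S₂) =
      r * (per (closedBall (0 : E3) 1) S₁ + per (closedBall (0 : E3) 1) S₂ -
        per (closedBall (0 : E3) 1) (S₁ ∪ S₂)) := by
  simp only [per_closedBall_eq_mul_perimeter hr, per_closedBall_eq_mul_perimeter one_pos, one_mul]
  ring

/-- **Free energy of a grain under a support-function gap (pair form).**  For a disjoint polyhedral pair,
compact convex origin-symmetric bodies `K, K', D ∋ 0` with `h_{K'}(ν) ≤ h_K(ν) + ε·h_D(ν)` for all `ν`:
`per K' S₂ − ι_{K'}(S₂,S₁) ≤ (per K S₂ − ι_K(S₂,S₁)) + ε·(per D S₂ − ι_D(S₂,S₁))` — the free energy of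
grain `S₂` is half its cross sum with the exterior cells (`exists_exterior_crossSums`), compared termwise
(`crossSum_le_add_of_supportFn_le`). -/
theorem pair_freeEnergy_le_add_of_gap {S₁ S₂ : Set E3}
    (hP₁ : ∃ (k : ℕ) (H : Fin k → Finset (E3 × ℝ)), S₁ = ⋃ i, polytope (H i))
    (hP₂ : ∃ (k : ℕ) (H : Fin k → Finset (E3 × ℝ)), S₂ = ⋃ i, polytope (H i))
    (hv₁ : volume S₁ < ⊤) (hv₂ : volume S₂ < ⊤) (hd : Disjoint S₁ S₂)
    {K K' D : Set E3} (hK : IsCompact K) (hKc : Convex ℝ K) (h0 : (0 : E3) ∈ K) (hKs : -K = K)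
    (hK' : IsCompact K') (hKc' : Convex ℝ K') (h0' : (0 : E3) ∈ K') (hKs' : -K' = K')
    (hD : IsCompact D) (hDc : Convex ℝ D) (hD0 : (0 : E3) ∈ D) (hDs : -D = D) {ε : ℝ}
    (hgap : ∀ ν : E3, supportFn K' ν ≤ supportFn K ν + ε * supportFn D ν) :
    per K' S₂ - (per K' S₂ + per K' S₁ - per K' (S₂ ∪ S₁)) / 2 ≤
      (per K S₂ - (per K S₂ + per K S₁ - per K (S₂ ∪ S₁)) / 2) +
        ε * (per D S₂ - (per D S₂ + per D S₁ - per D (S₂ ∪ S₁)) / 2) := by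
  classical
  obtain ⟨hPoly, hvol, hdisjG⟩ := pair_texture hP₁ hP₂ hv₁ hv₂ hd
  obtain ⟨k, H, ν, S, SX, -, hext, -⟩ :=
    exists_exterior_crossSums (![S₁, S₂] : Fin 2 → Set E3) hPoly hvol hdisjG
  set X : Set E3 → Fin k → Fin k → ℝ := fun L a b =>
    (if a < b then (supportFn L (ν a b) + supportFn L (-ν a b)) *
        facetArea (closure (polytope (H a)) ∩ closure (polytope (H b))) (ν a b)
      else (supportFn L (ν b a) + supportFn L (-ν b a)) *
        facetArea (closure (polytope (H b)) ∩ closure (polytope (H a))) (ν b a)) with hX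
  have herase : (Finset.univ.erase (1 : Fin 2)) = {0} := by decide
  -- the free energy of grain `S₂` is half its exterior cross sum, for every admissible body
  have hf : ∀ L : Set E3, IsCompact L → Convex ℝ L → (0 : E3) ∈ L → -L = L →
      per L S₂ - (per L S₂ + per L S₁ - per L (S₂ ∪ S₁)) / 2 = (∑ a ∈ S 1, ∑ b ∈ SX, X L a b) / 2 := by
    intro L hL hLc hL0 hLs
    have h : 2 * per L ((![S₁, S₂] : Fin 2 → Set E3) 1) =
        (∑ g ∈ Finset.univ.erase (1 : Fin 2), (per L ((![S₁, S₂] : Fin 2 → Set E3) 1) +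
          per L ((![S₁, S₂] : Fin 2 → Set E3) g) -
          per L (((![S₁, S₂] : Fin 2 → Set E3) 1) ∪ (![S₁, S₂] : Fin 2 → Set E3) g))) +
        ∑ a ∈ S 1, ∑ b ∈ SX, X L a b := hext L hL hLc hL0 hLs 1
    rw [herase, Finset.sum_singleton] at h
    have hG0 : (![S₁, S₂] : Fin 2 → Set E3) 0 = S₁ := rfl
    have hG1 : (![S₁, S₂] : Fin 2 → Set E3) 1 = S₂ := rfl
    rw [hG0, hG1] at h
    linarith
  have hsum := crossSum_le_add_of_supportFn_le hgap H ν (S 1) SX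
  rw [hf K hK hKc h0 hKs, hf K' hK' hKc' h0' hKs', hf D hD hDc hD0 hDs]
  simp only [hX] at hsum ⊢
  linarith

/-- **The free (exposed) area of a grain of a pair is nonnegative**:
`0 ≤ per B̄ S₂ − ι_{B̄}(S₂,S₁)` for `B̄ = B̄(0,1)` (half a cross sum with the exterior cells). -/
theorem pair_freeArea_nonneg {S₁ S₂ : Set E3}
    (hP₁ : ∃ (k : ℕ) (H : Fin k → Finset (E3 × ℝ)), S₁ = ⋃ i, polytope (H i))
    (hP₂ : ∃ (k : ℕ) (H : Fin k → Finset (E3 × ℝ)), S₂ = ⋃ i, polytope (H i))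
    (hv₁ : volume S₁ < ⊤) (hv₂ : volume S₂ < ⊤) (hd : Disjoint S₁ S₂) :
    0 ≤ per (closedBall (0 : E3) 1) S₂ - (per (closedBall (0 : E3) 1) S₂ +
      per (closedBall (0 : E3) 1) S₁ - per (closedBall (0 : E3) 1) (S₂ ∪ S₁)) / 2 := by
  classical
  obtain ⟨hPoly, hvol, hdisjG⟩ := pair_texture hP₁ hP₂ hv₁ hv₂ hd
  obtain ⟨k, H, ν, S, SX, -, hext, -⟩ :=
    exists_exterior_crossSums (![S₁, S₂] : Fin 2 → Set E3) hPoly hvol hdisjG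
  have hB : IsCompact (closedBall (0 : E3) 1) := isCompact_closedBall 0 1
  have hB0 : (0 : E3) ∈ closedBall (0 : E3) 1 := mem_closedBall_self zero_le_one
  have hBs : -closedBall (0 : E3) 1 = closedBall (0 : E3) 1 := by simp
  have herase : (Finset.univ.erase (1 : Fin 2)) = {0} := by decide
  have h := hext (closedBall (0 : E3) 1) hB (convex_closedBall 0 1) hB0 hBs 1
  rw [herase, Finset.sum_singleton] at h
  have hG0 : (![S₁, S₂] : Fin 2 → Set E3) 0 = S₁ := rfl
  have hG1 : (![S₁, S₂] : Fin 2 → Set E3) 1 = S₂ := rfl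
  rw [hG0, hG1] at h
  have hnn := crossSum_nonneg hB hB0 H ν (S 1) SX
  linarith

/-- **`per` is monotone in the body** on sets of finite perimeter: `K ⊆ K' ⊆ B̄(0,R)` gives
`per K S ≤ per K' S` (`per K'` is finite by `Per_{K'} ≤ R·Per`). -/
theorem per_mono_of_subset {K K' : Set E3} (hKK' : K ⊆ K') {R : ℝ} (hR : 0 < R)
    (hK'R : K' ⊆ closedBall (0 : E3) R) {S : Set E3} (hS : HasFinitePerimeter S) :
    per K S ≤ per K' S := by
  unfold per
  refine ENNReal.toReal_mono ?_ (anisotropicPerimeter_mono_left hKK' S)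
  rw [perK_eq_anisotropicPerimeter]
  exact ((anisotropicPerimeter_le_mul_perimeter hR hK'R S).trans_lt
    (ENNReal.mul_lt_top ENNReal.ofReal_lt_top hS.2)).ne

/-! ### The near-twin reduction at the level of bodies -/

/-- **Near-twin reduction, one-sided core** (C1-COST-g21 §7.1 with `|S₂| ≤ |S₁|`).  Disjoint polyhedral
grains `S₁, S₂` of finite volume with `|S₂| ≤ |S₁|`; bodies `W₁ ∋ 0` (compact convex, `⊆ B̄(0,√5)`),
`W₂ ∋ 0` (compact convex symmetric, `B̄(0,√3) ⊆ W₂ ⊆ B̄(0,√5)`), a twin body `W₂' ∋ 0` (compact convex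
symmetric) with `h_{W₂'} ≤ h_{W₂} + ε·h_{B̄(0,1)}`, a wall kernel `Dm ⊆ B̄(0,1)` (compact convex `∋ 0`),
`2(2√5 − 1)ε ≤ √3/3`, `c ≥ 1`, the Wulff bound for each grain, and the TWIN inequality for
`(W₁, W₂'; ½·Dm)` on `(S₁, S₂)`.  THEN the generic-form inequality for `(W₁, W₂; c·B̄(0,1))` holds on
`(S₁, S₂)`.  Proof: the pair-form facet calculus above feeds `nearTwin_arith` (p746232) with
`E` = the target energy, `Es` = the twin energy, `J = ι_{B̄}(S₁,S₂)`, `F` = the free area of `S₂`. -/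
theorem twoGrain_nearTwin_of_volume_le {S₁ S₂ : Set E3}
    (hP₁ : ∃ (k : ℕ) (H : Fin k → Finset (E3 × ℝ)), S₁ = ⋃ i, polytope (H i))
    (hP₂ : ∃ (k : ℕ) (H : Fin k → Finset (E3 × ℝ)), S₂ = ⋃ i, polytope (H i))
    (hv₁ : volume S₁ < ⊤) (hv₂ : volume S₂ < ⊤) (hd : Disjoint S₁ S₂)
    (h21 : volume S₂ ≤ volume S₁)
    {W₁ W₂ W₂' Dm : Set E3}
    (hW₁c : IsCompact W₁) (hW₁v : Convex ℝ W₁) (hW₁0 : (0 : E3) ∈ W₁)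
    (hW₂c : IsCompact W₂) (hW₂v : Convex ℝ W₂) (hW₂0 : (0 : E3) ∈ W₂) (hW₂s : -W₂ = W₂)
    (hW₂'c : IsCompact W₂') (hW₂'v : Convex ℝ W₂') (hW₂'0 : (0 : E3) ∈ W₂') (hW₂'s : -W₂' = W₂')
    (hDmc : IsCompact Dm) (hDmv : Convex ℝ Dm) (hDm0 : (0 : E3) ∈ Dm)
    (hW₁R : W₁ ⊆ closedBall (0 : E3) (Real.sqrt 5)) (hW₂R : W₂ ⊆ closedBall (0 : E3) (Real.sqrt 5))
    (hW₂r : closedBall (0 : E3) (Real.sqrt 3) ⊆ W₂) (hDm1 : Dm ⊆ closedBall (0 : E3) 1)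
    {ε c : ℝ} (hε : 2 * (2 * Real.sqrt 5 - 1) * ε ≤ Real.sqrt 3 / 3) (hc : 1 ≤ c)
    (hgap : ∀ ν : E3, supportFn W₂' ν ≤ supportFn W₂ ν + ε * supportFn (closedBall (0 : E3) 1) ν)
    (hWulff₁ : 6 * (2 : ℝ) ^ ((1 : ℝ) / 3) * (Real.sqrt 2 * (volume S₁).toReal) ^ ((2 : ℝ) / 3) ≤
      per W₁ S₁)
    (hWulff₂ : 6 * (2 : ℝ) ^ ((1 : ℝ) / 3) * (Real.sqrt 2 * (volume S₂).toReal) ^ ((2 : ℝ) / 3) ≤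
      per W₂ S₂)
    (htwin : 6 * (2 : ℝ) ^ ((1 : ℝ) / 3) * (Real.sqrt 2 * (volume (S₁ ∪ S₂)).toReal) ^ ((2 : ℝ) / 3) ≤
      (per W₁ S₁ - (per W₁ S₁ + per W₁ S₂ - per W₁ (S₁ ∪ S₂)) / 2) +
      (per W₂' S₂ - (per W₂' S₂ + per W₂' S₁ - per W₂' (S₂ ∪ S₁)) / 2) +
      1 / 2 * ((per Dm S₁ + per Dm S₂ - per Dm (S₁ ∪ S₂)) / 2)) :
    6 * (2 : ℝ) ^ ((1 : ℝ) / 3) * (Real.sqrt 2 * (volume (S₁ ∪ S₂)).toReal) ^ ((2 : ℝ) / 3) ≤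
      (per W₁ S₁ - (per W₁ S₁ + per W₁ S₂ - per W₁ (S₁ ∪ S₂)) / 2) +
      (per W₂ S₂ - (per W₂ S₂ + per W₂ S₁ - per W₂ (S₂ ∪ S₁)) / 2) +
      c * ((per (closedBall (0 : E3) 1) S₁ + per (closedBall (0 : E3) 1) S₂ -
        per (closedBall (0 : E3) 1) (S₁ ∪ S₂)) / 2) := by
  -- constants
  have h3pos : 0 < Real.sqrt 3 := Real.sqrt_pos.2 (by norm_num)
  have h5pos : 0 < Real.sqrt 5 := Real.sqrt_pos.2 (by norm_num)
  have hB : IsCompact (closedBall (0 : E3) 1) := isCompact_closedBall 0 1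
  have hBv : Convex ℝ (closedBall (0 : E3) 1) := convex_closedBall 0 1
  have hB0 : (0 : E3) ∈ closedBall (0 : E3) 1 := mem_closedBall_self zero_le_one
  have hBs : -closedBall (0 : E3) 1 = closedBall (0 : E3) 1 := by simp
  have hB5 : IsCompact (closedBall (0 : E3) (Real.sqrt 5)) := isCompact_closedBall 0 _
  have hB5v : Convex ℝ (closedBall (0 : E3) (Real.sqrt 5)) := convex_closedBall 0 _
  have hB50 : (0 : E3) ∈ closedBall (0 : E3) (Real.sqrt 5) := mem_closedBall_self h5pos.le
  -- volumes
  have hvol : (volume (S₁ ∪ S₂)).toReal = (volume S₁).toReal + (volume S₂).toReal :=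
    toReal_volume_union_pair hP₂ hv₁ hv₂ hd
  set V₁ : ℝ := (volume S₁).toReal with hV₁
  set V₂ : ℝ := (volume S₂).toReal with hV₂
  have hV₂0 : 0 ≤ V₂ := ENNReal.toReal_nonneg
  have hV21 : V₂ ≤ V₁ := ENNReal.toReal_mono hv₁.ne h21
  -- the reals of `nearTwin_arith`
  set J : ℝ := (per (closedBall (0 : E3) 1) S₁ + per (closedBall (0 : E3) 1) S₂ -
    per (closedBall (0 : E3) 1) (S₁ ∪ S₂)) / 2 with hJ
  set F : ℝ := per (closedBall (0 : E3) 1) S₂ - (per (closedBall (0 : E3) 1) S₂ +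
    per (closedBall (0 : E3) 1) S₁ - per (closedBall (0 : E3) 1) (S₂ ∪ S₁)) / 2 with hF
  -- (1) the wall term of the unit ball is nonnegative
  have hJ0 : 0 ≤ J := by
    have h := pair_iota_nonneg hP₁ hP₂ hv₁ hv₂ hd hB hBv hB0
    rw [hJ]; linarith
  -- (2) the Wulff-body wall terms are at most `√5·J`, the kernel's at most `J`
  have hι₁ : (per W₁ S₁ + per W₁ S₂ - per W₁ (S₁ ∪ S₂)) / 2 ≤ Real.sqrt 5 * J := by
    have h := pair_iota_mono hP₁ hP₂ hv₁ hv₂ hd hW₁c hW₁v hW₁0 hB5 hB5v hB50 hW₁R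
    rw [pair_iota_closedBall S₁ S₂ h5pos] at h
    rw [hJ]; linarith
  have hι₂ : (per W₂ S₂ + per W₂ S₁ - per W₂ (S₂ ∪ S₁)) / 2 ≤ Real.sqrt 5 * J := by
    have h := pair_iota_mono hP₁ hP₂ hv₁ hv₂ hd hW₂c hW₂v hW₂0 hB5 hB5v hB50 hW₂R
    rw [pair_iota_closedBall S₁ S₂ h5pos] at h
    rw [hJ, union_comm S₂ S₁]; linarith
  have hιm : (per Dm S₁ + per Dm S₂ - per Dm (S₁ ∪ S₂)) / 2 ≤ J := by
    have h := pair_iota_mono hP₁ hP₂ hv₁ hv₂ hd hDmc hDmv hDm0 hB hBv hB0 hDm1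
    rw [hJ]; linarith
  -- (3) the body change on grain 2 costs at most `ε·F`
  have hgap' : per W₂' S₂ - (per W₂' S₂ + per W₂' S₁ - per W₂' (S₂ ∪ S₁)) / 2 ≤
      (per W₂ S₂ - (per W₂ S₂ + per W₂ S₁ - per W₂ (S₂ ∪ S₁)) / 2) + ε * F :=
    pair_freeEnergy_le_add_of_gap hP₁ hP₂ hv₁ hv₂ hd hW₂c hW₂v hW₂0 hW₂s hW₂'c hW₂'v hW₂'0 hW₂'s
      hB hBv hB0 hBs hgap
  -- (4) the free area of grain 2: `0 ≤ F ≤ Per(S₂)` and `√3·Per(S₂) ≤ per W₂ S₂`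
  have hF0 : 0 ≤ F := pair_freeArea_nonneg hP₁ hP₂ hv₁ hv₂ hd
  have hFle : F ≤ per (closedBall (0 : E3) 1) S₂ := by
    have h := pair_iota_nonneg hP₁ hP₂ hv₁ hv₂ hd hB hBv hB0
    rw [hF, union_comm S₂ S₁]; linarith
  have hP₂ge : Real.sqrt 3 * per (closedBall (0 : E3) 1) S₂ ≤ per W₂ S₂ := by
    have h := per_mono_of_subset hW₂r h5pos hW₂R (hasFinitePerimeter_of_poly hP₂ hv₂)
    rw [per_closedBall_eq_mul_perimeter h3pos] at h
    rwa [per_closedBall_eq_mul_perimeter one_pos, one_mul]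
  have h6 : Real.sqrt 3 * F ≤ per W₂ S₂ :=
    (mul_le_mul_of_nonneg_left hFle h3pos.le).trans hP₂ge
  -- (5) assemble with the arithmetic core
  rw [hvol, mul_add] at htwin ⊢
  have hcJ : J ≤ c * J := le_mul_of_one_le_left hJ0 hc
  exact nearTwin_arith (J := J) (by positivity) (mul_nonneg (Real.sqrt_nonneg 2) hV₂0)
    (mul_le_mul_of_nonneg_left hV21 (Real.sqrt_nonneg 2)) hε hF0
    (by linarith) htwin (by linarith) hWulff₁ hWulff₂ h6

/-- **Near-twin reduction at the level of bodies** (C1-COST-g21 §7.1; no volume ordering).  As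
`twoGrain_nearTwin_of_volume_le`, with BOTH Wulff bodies symmetric with `B̄(0,√3) ⊆ W_i ⊆ B̄(0,√5)` and a
twin body on EITHER side: `W₂'` (gap to `W₂`, kernel `Dm`, twin inequality for `(W₁, W₂'; ½Dm)` on
`(S₁, S₂)`) and `W₁'` (gap to `W₁`, kernel `Dm'`, twin inequality for `(W₂, W₁'; ½Dm')` on `(S₂, S₁)` —
the shape lane P's named fact produces for the frame of grain 2).  Whichever grain is the smaller has
its law swapped. -/
theorem twoGrain_nearTwin {S₁ S₂ : Set E3}
    (hP₁ : ∃ (k : ℕ) (H : Fin k → Finset (E3 × ℝ)), S₁ = ⋃ i, polytope (H i))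
    (hP₂ : ∃ (k : ℕ) (H : Fin k → Finset (E3 × ℝ)), S₂ = ⋃ i, polytope (H i))
    (hv₁ : volume S₁ < ⊤) (hv₂ : volume S₂ < ⊤) (hd : Disjoint S₁ S₂)
    {W₁ W₂ W₁' W₂' Dm Dm' : Set E3}
    (hW₁c : IsCompact W₁) (hW₁v : Convex ℝ W₁) (hW₁0 : (0 : E3) ∈ W₁) (hW₁s : -W₁ = W₁)
    (hW₂c : IsCompact W₂) (hW₂v : Convex ℝ W₂) (hW₂0 : (0 : E3) ∈ W₂) (hW₂s : -W₂ = W₂)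
    (hW₁'c : IsCompact W₁') (hW₁'v : Convex ℝ W₁') (hW₁'0 : (0 : E3) ∈ W₁') (hW₁'s : -W₁' = W₁')
    (hW₂'c : IsCompact W₂') (hW₂'v : Convex ℝ W₂') (hW₂'0 : (0 : E3) ∈ W₂') (hW₂'s : -W₂' = W₂')
    (hDmc : IsCompact Dm) (hDmv : Convex ℝ Dm) (hDm0 : (0 : E3) ∈ Dm)
    (hDm'c : IsCompact Dm') (hDm'v : Convex ℝ Dm') (hDm'0 : (0 : E3) ∈ Dm')
    (hW₁R : W₁ ⊆ closedBall (0 : E3) (Real.sqrt 5)) (hW₂R : W₂ ⊆ closedBall (0 : E3) (Real.sqrt 5))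
    (hW₁r : closedBall (0 : E3) (Real.sqrt 3) ⊆ W₁) (hW₂r : closedBall (0 : E3) (Real.sqrt 3) ⊆ W₂)
    (hDm1 : Dm ⊆ closedBall (0 : E3) 1) (hDm'1 : Dm' ⊆ closedBall (0 : E3) 1)
    {ε c : ℝ} (hε : 2 * (2 * Real.sqrt 5 - 1) * ε ≤ Real.sqrt 3 / 3) (hc : 1 ≤ c)
    (hgap₂ : ∀ ν : E3, supportFn W₂' ν ≤ supportFn W₂ ν + ε * supportFn (closedBall (0 : E3) 1) ν)
    (hgap₁ : ∀ ν : E3, supportFn W₁' ν ≤ supportFn W₁ ν + ε * supportFn (closedBall (0 : E3) 1) ν)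
    (hWulff₁ : 6 * (2 : ℝ) ^ ((1 : ℝ) / 3) * (Real.sqrt 2 * (volume S₁).toReal) ^ ((2 : ℝ) / 3) ≤
      per W₁ S₁)
    (hWulff₂ : 6 * (2 : ℝ) ^ ((1 : ℝ) / 3) * (Real.sqrt 2 * (volume S₂).toReal) ^ ((2 : ℝ) / 3) ≤
      per W₂ S₂)
    (htwin₂ : 6 * (2 : ℝ) ^ ((1 : ℝ) / 3) * (Real.sqrt 2 * (volume (S₁ ∪ S₂)).toReal) ^ ((2 : ℝ) / 3) ≤
      (per W₁ S₁ - (per W₁ S₁ + per W₁ S₂ - per W₁ (S₁ ∪ S₂)) / 2) +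
      (per W₂' S₂ - (per W₂' S₂ + per W₂' S₁ - per W₂' (S₂ ∪ S₁)) / 2) +
      1 / 2 * ((per Dm S₁ + per Dm S₂ - per Dm (S₁ ∪ S₂)) / 2))
    (htwin₁ : 6 * (2 : ℝ) ^ ((1 : ℝ) / 3) * (Real.sqrt 2 * (volume (S₂ ∪ S₁)).toReal) ^ ((2 : ℝ) / 3) ≤
      (per W₂ S₂ - (per W₂ S₂ + per W₂ S₁ - per W₂ (S₂ ∪ S₁)) / 2) +
      (per W₁' S₁ - (per W₁' S₁ + per W₁' S₂ - per W₁' (S₁ ∪ S₂)) / 2) +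
      1 / 2 * ((per Dm' S₂ + per Dm' S₁ - per Dm' (S₂ ∪ S₁)) / 2)) :
    6 * (2 : ℝ) ^ ((1 : ℝ) / 3) * (Real.sqrt 2 * (volume (S₁ ∪ S₂)).toReal) ^ ((2 : ℝ) / 3) ≤
      (per W₁ S₁ - (per W₁ S₁ + per W₁ S₂ - per W₁ (S₁ ∪ S₂)) / 2) +
      (per W₂ S₂ - (per W₂ S₂ + per W₂ S₁ - per W₂ (S₂ ∪ S₁)) / 2) +
      c * ((per (closedBall (0 : E3) 1) S₁ + per (closedBall (0 : E3) 1) S₂ -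
        per (closedBall (0 : E3) 1) (S₁ ∪ S₂)) / 2) := by
  rcases le_total (volume S₂) (volume S₁) with h21 | h12
  · -- grain 2 is the smaller one: swap its law
    exact twoGrain_nearTwin_of_volume_le hP₁ hP₂ hv₁ hv₂ hd h21 hW₁c hW₁v hW₁0 hW₂c hW₂v hW₂0 hW₂s
      hW₂'c hW₂'v hW₂'0 hW₂'s hDmc hDmv hDm0 hW₁R hW₂R hW₂r hDm1 hε hc hgap₂ hWulff₁ hWulff₂ htwin₂
  · -- grain 1 is the smaller one: the core with the two grains exchanged
    have h := twoGrain_nearTwin_of_volume_le hP₂ hP₁ hv₂ hv₁ hd.symm h12 hW₂c hW₂v hW₂0 hW₁c hW₁v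
      hW₁0 hW₁s hW₁'c hW₁'v hW₁'0 hW₁'s hDm'c hDm'v hDm'0 hW₂R hW₁R hW₁r hDm'1 hε hc hgap₁ hWulff₂
      hWulff₁ htwin₁
    rw [union_comm S₂ S₁] at h ⊢
    linarith

end Summit.Ventures.Crystal3D.Theorems

end
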